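import Summits.SmoothPoincare4.SmoothPoincare4.Theses.WeylBudget
import Literature.Topology.FourManifolds.CorkPresentationHomotopySphere
import Literature.Topology.FourManifolds.CorkDecompositionInvolutive
import Summits.SmoothPoincare4.SmoothPoincare4.Theorems.WeylBudgetCorkRegluablePscStubCorkPresentation
import Summits.SmoothPoincare4.SmoothPoincare4.Theorems.WeylBudgetCorkRegluablePscStubIsometricRegluing
import Summits.SmoothPoincare4.SmoothPoincare4.Theorems.WeylBudgetCorkRegluablePscStubIsometricTransport
import Summits.SmoothPoincare4.SmoothPoincare4.Theorems.WeylBudgetCorkRegluablePscStubTransportSymmetricGerm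
import Summits.SmoothPoincare4.SmoothPoincare4.Theorems.WeylBudgetCorkRegluablePscStubSymmetricGluingOfBHData
import Literature.Geometry.Riemannian.BaerHankeMeanCurvatureIncrease
import Literature.Geometry.Riemannian.BaerHankeNormalFormProofs
import Literature.Topology.FourManifolds.ThetaFourKervaireMilnorFrontier
import Literature.Topology.FourManifolds.CorkDecompositionInvolutiveProofs
import Literature.Geometry.Riemannian.BaerHankeGluing
import Literature.Geometry.Riemannian.BaerHankeNormalForm
import Literature.Topology.FourManifolds.Gluing
import HarnessLib

/-!
# Line `birth` — BC3 skeleton for the crux `CorkRegluablePsc` (stmt-SmoothPoincare4-3206)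

**Status after lead c2, wave 1 (prover-line-stmt-SmoothPoincare4-3206-c2-0, 2026-08-17).**
`lean check`: rc 0, sorries 5 = THE BET `stub_simultaneousBHData` (2A, unchanged) + FOUR LITERATURE LEAVES, now cut
down to the tree's ACTUAL open frontier (wave-1 audit of the four fact-stubs; audit notes attached to the item):
`stub_bh28` is CLOSED (the fact `BarHanke2023_prop28_meanCurvatureIncrease` is discharged in the tree,
`…_holds`, `Literature/Geometry/Riemannian/BaerHankeMeanCurvatureIncrease.lean`; the stub LANDED as
`Summit.SmoothPoincare4.SmoothPoincare4.Theorems.stub_bh28`, p165805); `stub_thetaFour` (Θ₄ = 0) is DERIVED from the two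
open Kervaire–Milnor leaves `stub_kmThm31Four` (Thm. 3.1 at `n = 4`: every homotopy 4-sphere is s-parallelizable —
Kosinski IX (8.5), `m = 4`) and `stub_piStableFour` (`Π₄ = 0` = `Literature.Topology.FourManifolds.piStable_four_trivial`)
through the tree's PROVED `isHCobordant_sphere_of_homotopySphere_four_of_frontier₄` with the PROVED leaves (b)
`boundsParallelizable_of_collapseNullHomotopic_holds` and (5.1) `…boundsContractible_of_nullCobordism_isStablyParallelizable_four_holds`;
`stub_involutiveCorkTheorem` is DERIVED from the single open Matveyev leaf `stub_matveyevH4`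
(`Literature.Topology.FourManifolds.Matveyev1996_partOne_and_fact_of_dualSpheres.{0}`, (H4): Matveyev's part 1 + Fact 1
from the middle level on) through the PROVED `matveyev1996_involutiveDecomposition_of_dualSpheres` (middle-level dual
spheres (B) proved); `stub_bh27` stays the named fact `BarHanke2023_thm27_umbilicNormalForm` (fidelity audited OK clause by
clause against arXiv:2012.09127 Def. 21 / Thm. 27; the tree reduces it, sorry-free, to the boundary-cylinder core
`BarHanke2023_thm27_umbilicNormalForm_of_cylinderDeformation`'s hypothesis = BH Props. 23 + 26, an active programme).
Registered stubs: `stub_kmThm31Four`, `stub_piStableFour`, `stub_matveyevH4`, `stub_bh27`, `stub_simultaneousBHData`.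

**Status after lead c1 (prover-line-stmt-SmoothPoincare4-3206-c1-0, 2026-08-17, waves 1–3).**
`lean check`: rc 0, sorries 5 = FOUR NAMED FACTS OF THE TREE (`stub_thetaFour`, `stub_involutiveCorkTheorem`,
`stub_bh28` = `Literature.Geometry.Riemannian.BarHanke2023_prop28_meanCurvatureIncrease`, `stub_bh27` =
`Literature.Geometry.Riemannian.BarHanke2023_thm27_umbilicNormalForm`, the latter two vendored by this line, p155406)
+ THE BET `stub_simultaneousBHData` (2A: one pair of PSC piece metrics on cork and complement with boundary metrics
matching under `φ` AND `φ∘τ` and Bär–Hanke corner inequalities along both seams).  The former bet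
`stub_symmetricPscGerm` is DERIVED (`symmetricPscGerm_of_stubs`) from 2A, the LANDED conditional
`…Theorems.stub_symmetricGluingOfBHData_of_bhFacts` (p162100; contains the LANDED collar gluing `…stub_collarGluing`,
p160756) and the LANDED `…Theorems.stub_transportSymmetricGerm` (p155387).  Lead c1's report:
`Cruxes/CorkRegluablePsc/LeadC1-CoreAnalysis.md`.

**Status after the lead's cycle 1 (prover-line-stmt-SmoothPoincare4-3206-0, 2026-08-17)** (kept for history):
`lean check`: rc 0, sorries 3.  CLOSED: `stub_isometricRegluing` (= landed
`Summit.SmoothPoincare4.SmoothPoincare4.Theorems.stub_isometricRegluing`, p149812),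
`stub_isometricTransport` (= landed `…Theorems.stub_isometricTransport`, p147438),
`stub_corkPresentation` (DERIVED from the landed conditional `…Theorems.stub_corkPresentation_of_facts`,
p149863, and the two fact-stubs below), `corkRegluablePsc_of_stubSigs`, `CorkRegluablePsc_of`.
OPEN (the three `sorry`s): `stub_thetaFour` = the tree's named fact
`Literature.Topology.FourManifolds.isHCobordant_sphere_of_homotopySphere_four` (Θ₄ = 0, Kervaire–Milnor;
XL literature debt), `stub_involutiveCorkTheorem` = the tree's named fact
`Literature.Topology.FourManifolds.matveyev1996_involutiveDecomposition` (cork theorem with involution,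
landed as a fact p147251; XL literature debt), and `stub_symmetricPscGerm` (THE BET: a τ-equivariant
two-sided PSC fill-in along the cork boundary in `S⁴`; open in print — it implies PSC on every homotopy
4-sphere and is not implied by SPC4, being universally quantified over cork presentations).

Route `WeylBudget` (route-SmoothPoincare4-WeylBudget), crux #3 `CorkRegluablePsc` (rank 3, "L"):
every homotopy 4-sphere `Σ` is an ISOMETRIC cork regluing of SOME positive-scalar-curvature
metric on `S⁴` — pieces `C` (compact contractible), `V`, smooth embeddings `jC, jV` covering `S⁴`
and `kC, kV` covering `Σ` (meeting only along `∂C`-images), Riemannian metrics `g` on `S⁴` (scal > 0,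
Levi-Civita) and `γ` on `Σ` with the SAME piece metrics `jC^* g = kC^* γ`, `jV^* g = kV^* γ`.

Skeleton registrar (planner one-shot `skel-stmt-SmoothPoincare4-3206`, 2026-08-17).  THE LINE is the
route header's own two-layer plan for this node ("CorkRegluablePsc ⇐ SymmetricGerm → JetFlexibility"),
typed over the tree's gluing vocabulary (`BoundaryData`, `IsBoundaryGluing`, Hirsch Ch. 8) and cut into
four named statements, exactly one of which carries the open geometric content:

* `stub_corkPresentation` — TOPOLOGY (XL literature leaf): every homotopy 4-sphere is a cork twist of the
  standard `S⁴` by an INVOLUTION: `S⁴ = C ∪_φ W`, `Σ = C ∪_(φ∘τ) W` with `C` compact contractible, `W`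
  compact, `τ ∈ Diff(∂C)` involutive.  Without `Function.Involutive τ` this is VERBATIM the conclusion of
  the tree's PROVED packaging `Literature.Topology.FourManifolds.HomotopySphere.exists_corkPresentation_of_facts`
  (from the named facts `Θ₄ = 0` = `isHCobordant_sphere_of_homotopySphere_four` and
  `Matveyev1996_decomposition`); the involution refinement is the printed cork theorem as stated in
  Akbulut–Yasui 2008, Thm. 1.1 (arXiv:0806.3010 p. 3, READ 2026-08-17: "removing a contractible 4-manifold
  and gluing it via an involution on the boundary", credited to Matveyev 1996, Curtis–Freedman–Hsiang–Stong
  1996, Akbulut–Matveyev 1998) — not in the tree (`corkDecomposition`'s docstring: "the refinement that τ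
  can be chosen to be an involution … is not part of this statement").  The involution is what the geometric stub consumes
  (a τ-invariant metric on `∂C` exists iff τ generates a relatively compact group; averaging).
* `stub_symmetricPscGerm` — THE BET (the crux's geometric heart, stated on the STANDARD sphere only; L/open):
  for every splitting `S⁴ = C ∪_φ W` (`C` compact contractible) and every involution `τ` of `∂C` there is a
  Riemannian metric `g` on `S⁴` with `scal_g > 0` whose GERM along the seam `Y = jC(∂C)` is τ-symmetric:
  an open `U ⊇ Y` and a map `T`, smooth involutive and `g`-isometric on `U`, preserving the two sides
  (`T x ∈ jC(C) ↔ x ∈ jC(C)`) and restricting to `τ` on `Y` (`T ∘ jC ∘ incl = jC ∘ incl ∘ τ`).  Germ form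
  ⟸ jet form: if the normal ∞-jet of a PSC metric along `Y` is τ-invariant, averaging `h_t ↦ ½(h_t + τ^*h_t)`
  in Fermi coordinates changes `g` by a flat (hence C²-small near `Y`) tensor and yields an honest isometric
  involution `τ × id` with scal still > 0 — so this stub is exactly SymmetricGerm + JetFlexibility of the
  route's plan (BarHanke2023 local flexibility for the jets; the 1-jet = metric + second fundamental form
  is the 'PSC wall' question of the crux's why-might-fail; LawsonMichelsohn1984: the mean-convex half is free).
* `stub_isometricRegluing` — DIFFERENTIAL TOPOLOGY (M/L, provable with the tree's open-gluing tools,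
  `IsOpenGluing`, `OpenGluingIsManifold`): cut `(S⁴, g)` along `Y` and reglue by the germ isometry `T`:
  the open gluing `X := (jC(C) ∪ U) ⊔ (S⁴ ∖ jC(C)) / (p ∼ T p, p ∈ U ∖ jC(C))` is a Hausdorff (the graph of
  `T|(U ∖ jC C)` is closed: limits on `Y` are excluded because `T(Y) = Y ⊆ jC(C)`) second-countable smooth
  4-manifold carrying the metric `γ := g ⊔ g` (compatible since `T^* g = g`), with piece embeddings
  `kC := [jC]`, `kW := [jW]` off `U` and `[T ∘ jW]` near `∂W` (consistent because `T² = id`), covering `X`,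
  meeting exactly along `incl z ∼ incl (φ (τ z))` (uses `T ∘ jC ∘ incl = jC ∘ incl ∘ τ` and `τ² = id`), and
  `kC^* γ = jC^* g`, `kW^* γ = jW^* T^* g = jW^* g`.  So `X = C ∪_(φ∘τ) W` is an isometric regluing of `(S⁴, g)`.
* `stub_isometricTransport` — GLUING UNIQUENESS + NATURALITY (M, provable now): two gluings `X`, `X'` of the
  same compact pieces along the same `ψ : ∂C ≅ ∂W` are diffeomorphic (Hirsch Ch. 8 Thm. 2.1, PROVED in the
  tree: `Literature.Topology.FourManifolds.nonempty_diffeomorph_of_isBoundaryGluing_holds`), and pushing a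
  Riemannian metric `γ` and the piece embeddings forward along `F : X ≅ X'` (`γ' := (F⁻¹)^* γ` =
  `PseudoRiemannianMetric.comap`, `kC' := F ∘ kC`; `pullbackBilin_comp`) preserves the piece pullbacks.
  This moves the reglued metric from the constructed `X` to the GIVEN carrier `S.carrier`.

Composition (`corkRegluablePsc_of_stubSigs`, sorry-free, standard axioms; `CorkRegluablePsc_of` feeds it
the four stubs and concludes the crux BY NAME): present `Σ` (stub 1), destructure `S⁴ = C ∪_φ W` into
`jC, jW`; get `(g, U, T)` (stub 2); reglue to `(X, kC₀, kW₀, γ₀)` (stub 3); transport to `S.carrier` along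
gluing uniqueness for `ψ = φ ∘ τ` (stub 4); the crux's two "seam ⇒ boundary" clauses follow from the seam
relations and `BoundaryData.range_incl`, and `jC^* g = kC₀^* γ₀ = kC^* γ`.

Honest sizes: stub 1 XL (cork theorem; shared leaf with routes IsotropicCorkBracketing / PscCorkFillIn up
to the involution clause), stub 2 = the crux's open content (implies PSC on every homotopy 4-sphere via
stubs 1, 3, 4 and `RegluablePscGivesPsc`, open in print: KumarSen2025), stub 3 M/L, stub 4 M.
`sorry` occurs ONLY in the four `stub_*` theorems.  Disproof used: none (no `Cruxes/CorkRegluablePsc/Disproof.lean`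
exists at registration; `ledger negatives --problem SmoothPoincare4` checked — no stub is an instance of a
refuted statement).
-/

noncomputable section

-- `Summit.<Summit>.<Problem>`: for the single-conjunct summit the duplicate component is mandated.
set_option linter.dupNamespace false
set_option linter.unusedVariables false

open scoped Manifold ContDiff Topology

namespace Summit.SmoothPoincare4.SmoothPoincare4.Cruxes.CorkRegluablePsc.Birth

/-! ## The registered stubs

Reshape (lead, cycle 1, 2026-08-17): the topological leaf `stub_corkPresentation` is now DERIVED
(`stub_corkPresentation` below is a theorem, no `sorry`) from the landed conditional helper
`Summit.SmoothPoincare4.SmoothPoincare4.Theorems.stub_corkPresentation_of_facts` (p149863) and two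
stubs that are LITERALLY named facts of the tree — `stub_thetaFour` (`Θ₄ = 0`,
`Literature.Topology.FourManifolds.isHCobordant_sphere_of_homotopySphere_four`, Kervaire–Milnor 1963)
and `stub_involutiveCorkTheorem` (`Literature.Topology.FourManifolds.matveyev1996_involutiveDecomposition`,
Matveyev 1996 / Kirby 1996 Addendum (D), landed as a named fact p147251) — so that the skeleton is
closed MODULO exactly: these two literature facts + the geometric bet `stub_symmetricPscGerm`.
Stubs 3 and 4 are the landed theorems `…Theorems.stub_isometricRegluing` (p149812) and
`…Theorems.stub_isometricTransport` (p147438). -/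

/-! ### Stubs 1a / 1b, reshaped by the lead (cycle c2, wave 1, 2026-08-17)

The two topological fact-stubs are cut down to the tree's actual open LEAVES (wave-1 audit): the tree
proves `Θ₄ = 0` from Kervaire–Milnor's chain with every link discharged except Thm. 3.1 at `n = 4` and
`Π₄ = 0`, and proves the involutive cork theorem from Matveyev's construction with every link discharged
except (H4). -/

/-- **Stub 1a-i — Kervaire–Milnor Thm. 3.1 at `n = 4`: every homotopy 4-sphere is s-parallelizable**
(the hypothesis `h31` of the tree's proved `isHCobordant_sphere_of_homotopySphere_four_of_frontier₄`;
printed proof Case 2, `π₃(SO) = ℤ`, obstruction killed by `p₁ = 3σ = 0`: Kosinski IX (8.5) at `m = 4`,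
whose tree rendering `Kosinski1993_thm85_fourMul_homologySphere` at `k = 1` gives this instance through the
proved `HomotopySphere.isStablyParallelizable_four_mul_of_sig`).  Closes by `exact` from a discharge of
either.  Size XL (Pontryagin class / signature theorem; not a prover task of this line).
[cite: KervaireMilnorAnnals1963, §3, Thm. 3.1 and its proof, Case 2 (p. 508)]
[cite: Kosinski1993, Ch. IX, Thm. (8.5), clause m = 4k] -/
theorem stub_kmThm31Four :
    ∀ S : Literature.Topology.FourManifolds.HomotopySphere 4,
      Literature.Topology.FourManifolds.IsStablyParallelizable (𝓡 4) S.carrier := by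
  sorry

/-- **Stub 1a-ii — `Π₄ = 0`** (named fact of the tree `Literature.Topology.FourManifolds.piStable_four_trivial`:
every map `S⁴⁺ᵏ → Sᵏ = OnePoint ℝᵏ`, `k > 5`, is null-homotopic; Kervaire–Milnor 1963, table p. 512;
`⇔ π₁₀(S⁶) = 0`).  Closes by `exact` from a discharge `piStable_four_trivial_holds`.  Size XL (stable
homotopy; not a prover task of this line). [cite: KervaireMilnorAnnals1963, §4, table p. 512 (Π₄ = 0)] -/
theorem stub_piStableFour : Literature.Topology.FourManifolds.piStable_four_trivial := by
  sorry

/-- **Stub 1a (derived) — `Θ₄ = 0`**: every homotopy 4-sphere is h-cobordant to `S⁴`, now a THEOREM over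
the two leaves `stub_kmThm31Four`, `stub_piStableFour` by the tree's proved Kervaire–Milnor chain
(`isHCobordant_sphere_of_homotopySphere_four_of_frontier₄`: Lemma 2.3 ⇐, §4 with the proved framed
embedding (a) and Pontryagin–Thom Lemma 4.2 (b) `boundsParallelizable_of_collapseNullHomotopic_holds`,
Thm. 5.1 at `k = 2` `…boundsContractible_of_nullCobordism_isStablyParallelizable_four_holds`).
[cite: KervaireMilnorAnnals1963, table p. 504 (Θ₄ = 0) via Lemma 2.3, Thm. 3.1, §4, Thm. 5.1] -/
theorem stub_thetaFour :
    Literature.Topology.FourManifolds.isHCobordant_sphere_of_homotopySphere_four :=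
  Literature.Topology.FourManifolds.isHCobordant_sphere_of_homotopySphere_four_of_frontier₄
    stub_kmThm31Four
    Literature.Topology.FourManifolds.boundsParallelizable_of_collapseNullHomotopic_holds
    stub_piStableFour
    Literature.Topology.FourManifolds.HomotopySphere.boundsContractible_of_nullCobordism_isStablyParallelizable_four_holds

/-- **Stub 1b-i — (H4) Matveyev's Theorem part 1 with Fact 1, from the middle level on** (named fact of
the tree `Literature.Topology.FourManifolds.Matveyev1996_partOne_and_fact_of_dualSpheres`, universe 0:
given two algebraically dual framed families of 2-spheres in a simply connected closed `N⁴` with surgeries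
giving `X₁`, `X₂`, the decompositions `Xᵢ = Wᵢ ∪ M` with `Wᵢ` compact contractible, `D(W₁) = S⁴ = W₁ ∪ W₂`;
Matveyev 1996 pp. 1–3, Kirby 1996 §3–4).  Closes by `exact` from a discharge
`Matveyev1996_partOne_and_fact_of_dualSpheres_holds`.  Size XL (Casson moves, Kirby calculus; not a
prover task of this line). [cite: Matveyev1996, Proof of Theorem (pp. 1–2) and Fact 1 (p. 3)]
[cite: KirbyCorks1996, §3 and §4 Addenda (B), (C)] -/
theorem stub_matveyevH4 :
    Literature.Topology.FourManifolds.Matveyev1996_partOne_and_fact_of_dualSpheres.{0} := by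
  sorry

/-- **Stub 1b (derived) — the cork theorem with involution**
(`Literature.Topology.FourManifolds.matveyev1996_involutiveDecomposition`, Matveyev 1996 Theorem + Kirby 1996
Addendum (D); Curtis–Freedman–Hsiang–Stong 1996): h-cobordant simply connected closed smooth 4-manifolds are
`C ∪_φ W` and `C ∪_(φ∘τ) W` with `C` compact contractible and `τ` an involution of `∂C`; now a THEOREM over
the single leaf `stub_matveyevH4` by the tree's proved `matveyev1996_involutiveDecomposition_of_dualSpheres`
(middle-level dual spheres (B) `exists_dualSpheres_middleLevel_of_two_three_holds` and the involution
`W₁ ♮ W₂ ↔ W₂ ♮ W₁` proved). [cite: Matveyev1996, Theorem] [cite: KirbyCorks1996, Theorem and Addendum (D)] -/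
theorem stub_involutiveCorkTheorem :
    Literature.Topology.FourManifolds.matveyev1996_involutiveDecomposition :=
  Literature.Topology.FourManifolds.matveyev1996_involutiveDecomposition_of_dualSpheres stub_matveyevH4

/-- **Stub 1 — cork presentation of homotopy 4-spheres by an involution (topology, XL leaf).**
Every homotopy 4-sphere `Σ` is `C ∪_(φ∘τ) W` where `S⁴ = C ∪_φ W`, `C` compact contractible, `W` compact
(smooth 4-manifolds with boundary, Hausdorff, second countable), `φ : ∂C ≅ ∂W`, and `τ : ∂C ≅ ∂C` an
INVOLUTION.  Minus `Function.Involutive τ` this is verbatim the conclusion of the tree's proved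
`HomotopySphere.exists_corkPresentation_of_facts` (`Θ₄ = 0` + Matveyev's two-piece cork theorem); the
involution clause is the printed refinement (Akbulut–Yasui 2008 Thm. 1.1, arXiv:0806.3010 p. 3, read).
Sources: CurtisFreedmanHsiangStong1996 (Theorem), Matveyev1996 (Theorem), KirbyCorks1996,
AkbulutMatveyev1998, arXiv:0806.3010 (Thm. 1.1), KervaireMilnorAnnals1963 (Θ₄ = 0). -/
theorem stub_corkPresentation :
    ∀ S : Literature.Topology.FourManifolds.HomotopySphere 4, ∃ (C : Type) (_ : TopologicalSpace C) (_ : T2Space C)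
    (_ : SecondCountableTopology C) (_ : ChartedSpace (EuclideanHalfSpace 4) C)
    (_ : IsManifold (𝓡∂ 4) ∞ C) (_ : CompactSpace C) (_ : ContractibleSpace C)
    (bC : Literature.Topology.FourManifolds.BoundaryData (𝓡∂ 4) C (𝓡 3))
    (W : Type) (_ : TopologicalSpace W) (_ : T2Space W) (_ : SecondCountableTopology W)
    (_ : ChartedSpace (EuclideanHalfSpace 4) W) (_ : IsManifold (𝓡∂ 4) ∞ W) (_ : CompactSpace W)
    (bW : Literature.Topology.FourManifolds.BoundaryData (𝓡∂ 4) W (𝓡 3))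
    (φ : bC.carrier ≃ₘ⟮𝓡 3, 𝓡 3⟯ bW.carrier) (τ : bC.carrier ≃ₘ⟮𝓡 3, 𝓡 3⟯ bC.carrier),
    Function.Involutive τ ∧
    Literature.Topology.FourManifolds.IsBoundaryGluing bC bW φ (𝓡 4) (Metric.sphere (0 : EuclideanSpace ℝ (Fin 5)) 1) ∧
    Literature.Topology.FourManifolds.IsBoundaryGluing bC bW (τ.trans φ) (𝓡 4) S.carrier :=
  _root_.Summit.SmoothPoincare4.SmoothPoincare4.Theorems.stub_corkPresentation_of_facts
    stub_thetaFour stub_involutiveCorkTheorem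

/-! ### Stub 2, reshaped by the lead (cycle c1, 2026-08-17)

`stub_symmetricPscGerm` (a PSC metric on `S⁴` with a τ-symmetric germ along the cork boundary) is now
DERIVED (`symmetricPscGerm_of_stubs`, sorry-free) from three registered stubs:

* `stub_simultaneousBHData` — THE BET, first-order and two-piece: ONE pair of PSC metrics `g_C` on the
  cork and `g_W` on the complement whose boundary metrics match under `φ` AND under `φ ∘ τ` (equivalently:
  the common boundary metric `h` is τ-invariant) and whose outward mean curvatures satisfy the Bär–Hanke /
  Miao corner condition `H_C + H_W ≥ 0` along BOTH seams — verbatim the hypothesis block of the tree's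
  named fact `Literature.Geometry.Riemannian.BaerHankePscGluing.dim_four` for the two gluings
  `S⁴ = C ∪_φ W` and `Σ = C ∪_(φ∘τ) W` simultaneously (so it gives PSC on `Σ` at once through that fact);
* `stub_symmetricGluingOfBHData` — PUBLISHED DEFORMATION THEORY + PLUMBING: such a pair glues, on SOME
  smooth closed 4-manifold `P = C ∪_φ W`, to a PSC metric with an isometric side-preserving involution
  `T ⊇ τ` near the seam.  Proof in print: Bär–Hanke 2023 Prop. 28 (make both corner inequalities strict,
  boundary metric fixed), choose a smooth τ-invariant `λ` with `λ ≤ H_C/3`, `-λ ≤ (H_W ∘ φ)/3`, Bär–Hanke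
  Thm. 27 (master theorem, `k = λ h` on `C`, `k = -(λ∘φ⁻¹) φ_*h` on `W`, same `C`-normality constant):
  both metrics become `dt² + (1 - 2λt - Ct²) h` in their normal collars, so on `P` (smooth structure from
  the collars) the metric is `dr² + (1 + 2λ(y) r - C r²) h_y` for `r ∈ (-ε, ε)` — smooth, no corner, PSC,
  and `T := τ × id` is an isometry because `τ^* h = h`, `λ ∘ τ = λ`;
* `stub_transportSymmetricGerm` — transport of `(jC, jW, g, U, T)` from `P` to the standard `S⁴` along
  gluing uniqueness (`nonempty_diffeomorph_of_isBoundaryGluing_holds`, PROVED), exactly as the landed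
  `stub_isometricTransport` does on the `Σ` side (M, provable now).

Consequently the piece embeddings `jC, jW` of `S⁴` are now CHOSEN by stub 2 (the crux is existential in
them) instead of being imposed by the destructured cork presentation; the composition below is adapted. -/

/-- **Stub 2A — simultaneous Bär–Hanke data for `S⁴ = C ∪_φ W` and `Σ = C ∪_(φ∘τ) W` (THE BET).**
For an involutive cork presentation (`C` compact contractible, `W` compact, `τ` an involution of `∂C`,
`S⁴ = C ∪_φ W`, `Σ = C ∪_(φ∘τ) W` a homotopy 4-sphere): Riemannian PSC metrics `g_C` on `C` and `g_W` on `W`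
with smooth outward unit normals along the boundaries such that (i) the induced boundary forms agree under
`φ` and under `φ ∘ τ` (⇔ `h := incl_C^* g_C` is τ-invariant and `φ_* h = incl_W^* g_W`), and (ii) the
outward mean curvatures (tree convention `H = tr K_ν`, `K_ν(v,w) = g(∇_v ν, w)`) satisfy
`H_C(z) + H_W(φ z) ≥ 0` and `H_C(z) + H_W(φ (τ z)) ≥ 0` for all `z : ∂C`.  Each conjunct block is VERBATIM
the hypothesis of `Literature.Geometry.Riemannian.BaerHankePscGluing.dim_four` (Bär–Hanke 2023, Thm. 42)
for the respective gluing.  Equivalent (modulo Bär–Hanke 2023 Prop. 28 / Thm. 27 and plumbing, see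
`stub_symmetricGluingOfBHData`) to the former `stub_symmetricPscGerm`; strictly contains the crux
`MeanConvexTwistedPair` of route PscCorkFillIn (one gluing) plus τ-invariance of the cork-side boundary
metric.  Why plausibly true: Mazur corks carry PSC metrics with `H > 0` (Sweeney 2026 Prop. 1.2 =
`Literature.Geometry.Riemannian.Sweeney2026_pscMeanConvex`, after Lawson–Michelsohn 1984), boundary metrics
of PSC metrics are completely flexible WITHOUT the sign condition (Shi–Wang–Wei 2022 Thm. 1.1 =
`Literature.Geometry.Riemannian.ShiWangWei2022_boundaryMetric_extends_psc`), and a τ-invariant `h` costs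
nothing by itself (average); why it might fail: mean-convex PSC fill-ins with PRESCRIBED boundary metric are
a Gromov fill-in problem (Miao 2021 / Shi–Wang–Wei 2022 Thm. 1.2: no NNSC fill-in once `H` is pointwise
large), the quasi-spherical collars that change a boundary metric keep `H > 0` only over paths of
nonnegative scalar curvature (Shi–Wang–Wei 2022 Lemma 3.1) and `∂C` carries no such metric, and through
`BaerHankePscGluing` the statement gives PSC on every homotopy 4-sphere (open in print).  Size L / open.
[cite: BarHanke2023, §4.4 Thm. 42; ShiWangWei2022, Thm. 1.1, Thm. 1.2, Lemma 3.1; Sweeney2026, Prop. 1.2] -/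
theorem stub_simultaneousBHData :
    ∀ (C : Type) [TopologicalSpace C] [T2Space C] [SecondCountableTopology C]
    [ChartedSpace (EuclideanHalfSpace 4) C] [IsManifold (𝓡∂ 4) ∞ C] [CompactSpace C]
    [ContractibleSpace C]
    (bC : Literature.Topology.FourManifolds.BoundaryData (𝓡∂ 4) C (𝓡 3))
    (W : Type) [TopologicalSpace W] [T2Space W] [SecondCountableTopology W]
    [ChartedSpace (EuclideanHalfSpace 4) W] [IsManifold (𝓡∂ 4) ∞ W] [CompactSpace W]
    (bW : Literature.Topology.FourManifolds.BoundaryData (𝓡∂ 4) W (𝓡 3))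
    (φ : bC.carrier ≃ₘ⟮𝓡 3, 𝓡 3⟯ bW.carrier) (τ : bC.carrier ≃ₘ⟮𝓡 3, 𝓡 3⟯ bC.carrier),
    Function.Involutive τ →
    Literature.Topology.FourManifolds.IsBoundaryGluing bC bW φ (𝓡 4) (Metric.sphere (0 : EuclideanSpace ℝ (Fin 5)) 1) →
    (∀ S : Literature.Topology.FourManifolds.HomotopySphere 4,
      Literature.Topology.FourManifolds.IsBoundaryGluing bC bW (τ.trans φ) (𝓡 4) S.carrier →
    ∃ (gC : Literature.Geometry.Lorentzian.PseudoRiemannianMetric (𝓡∂ 4) ∞ (EuclideanSpace ℝ (Fin 4)) (TangentSpace (𝓡∂ 4) : C → Type _))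
    (_ : gC.HasLeviCivita) (hfC : gC.IsSpacelikeImmersion (𝓡 3) bC.incl)
    (νC : Literature.Geometry.Lorentzian.NormalField (𝓡∂ 4) bC.incl)
    (gW : Literature.Geometry.Lorentzian.PseudoRiemannianMetric (𝓡∂ 4) ∞ (EuclideanSpace ℝ (Fin 4)) (TangentSpace (𝓡∂ 4) : W → Type _))
    (_ : gW.HasLeviCivita) (hfW : gW.IsSpacelikeImmersion (𝓡 3) bW.incl)
    (νW : Literature.Geometry.Lorentzian.NormalField (𝓡∂ 4) bW.incl),
    (gC.IsRiemannian ∧ (∀ x, 0 < gC.scalarCurvature x) ∧ gC.IsUnitNormal (𝓡 3) bC.incl νC 1 ∧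
      ContMDiff (𝓡 3) (𝓡∂ 4).tangent ∞ (fun z ↦ (Bundle.TotalSpace.mk' (EuclideanSpace ℝ (Fin 4)) (bC.incl z) (νC z) : TangentBundle (𝓡∂ 4) C)) ∧
      (∀ z, (show EuclideanSpace ℝ (Fin 4) from νC z) 0 < 0)) ∧
    (gW.IsRiemannian ∧ (∀ x, 0 < gW.scalarCurvature x) ∧ gW.IsUnitNormal (𝓡 3) bW.incl νW 1 ∧
      ContMDiff (𝓡 3) (𝓡∂ 4).tangent ∞ (fun w ↦ (Bundle.TotalSpace.mk' (EuclideanSpace ℝ (Fin 4)) (bW.incl w) (νW w) : TangentBundle (𝓡∂ 4) W)) ∧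
      (∀ w, (show EuclideanSpace ℝ (Fin 4) from νW w) 0 < 0)) ∧
    (∀ z, Literature.Geometry.Lorentzian.pullbackBilin (I := 𝓡∂ 4) (I' := 𝓡 3) bC.incl gC.val z =
      Literature.Geometry.Lorentzian.pullbackBilin (I := 𝓡∂ 4) (I' := 𝓡 3) (bW.incl ∘ φ) gW.val z) ∧
    (∀ z, Literature.Geometry.Lorentzian.pullbackBilin (I := 𝓡∂ 4) (I' := 𝓡 3) bC.incl gC.val z =
      Literature.Geometry.Lorentzian.pullbackBilin (I := 𝓡∂ 4) (I' := 𝓡 3) (bW.incl ∘ φ ∘ τ) gW.val z) ∧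
    (∀ z, 0 ≤ gC.meanCurvature bC.incl Literature.Geometry.Lorentzian.PseudoRiemannianMetric.contMDiff_pullbackBilin_holds hfC νC z +
      gW.meanCurvature bW.incl Literature.Geometry.Lorentzian.PseudoRiemannianMetric.contMDiff_pullbackBilin_holds hfW νW (φ z)) ∧
    (∀ z, 0 ≤ gC.meanCurvature bC.incl Literature.Geometry.Lorentzian.PseudoRiemannianMetric.contMDiff_pullbackBilin_holds hfC νC z +
      gW.meanCurvature bW.incl Literature.Geometry.Lorentzian.PseudoRiemannianMetric.contMDiff_pullbackBilin_holds hfW νW (φ (τ z)))) := by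
  sorry

/-! ### Stub 2B, reshaped by the lead (cycle c1, wave 2 → 3)

`stub_symmetricGluingOfBHData` is now DERIVED from two FACT-stubs — the named facts
`Literature.Geometry.Riemannian.BarHanke2023_prop28_meanCurvatureIncrease` and
`Literature.Geometry.Riemannian.BarHanke2023_thm27_umbilicNormalForm` (Bär–Hanke 2023 §3 Prop. 28 /
Thm. 27 with Def. 21, vendored by this line and LANDED p155406, `Literature/Geometry/Riemannian/BaerHankeNormalForm.lean`)
— through the LANDED conditional `stub_symmetricGluingOfBHData_of_bhFacts` (p162100), whose construction half, the
τ-equivariant collar gluing `stub_collarGluing` (glue two umbilic `C₀`-normal collared PSC metrics back to back), LANDED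
as p160756 with seven proved Literature support files. -/

/-- **Stub 2B-i — Bär–Hanke 2023, Prop. 28** (named fact of the tree, vendored by this line, p155406):
the outward mean curvature of a PSC metric can be raised by a positive constant keeping the boundary metric
and `scal > 0`.  Literally `Literature.Geometry.Riemannian.BarHanke2023_prop28_meanCurvatureIncrease`;
CLOSED (lead c2, wave 1): the fact is discharged in the tree (`BarHanke2023_prop28_meanCurvatureIncrease_holds`,
`Literature/Geometry/Riemannian/BaerHankeMeanCurvatureIncrease.lean`, following the printed proof: boundary normal
coordinates of an extension to the double, conformal deformation `e^{-δψ(t)} g_t + dt²` of the slices,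
`H ↦ H + ½δ(m+1)`, small `δ` by continuity of `scal` and compactness) and the stub LANDED as
`Summit.SmoothPoincare4.SmoothPoincare4.Theorems.stub_bh28` (p165805). [cite: BarHanke2023, §3 Prop. 28] -/
theorem stub_bh28 : Literature.Geometry.Riemannian.BarHanke2023_prop28_meanCurvatureIncrease :=
  Literature.Geometry.Riemannian.BarHanke2023_prop28_meanCurvatureIncrease_holds

/-- **Stub 2B-ii — Bär–Hanke 2023, Thm. 27 (master deformation theorem), umbilic C-normal form**
(named fact of the tree, vendored by this line, p155406): a PSC metric with `(m+1)·μ ≤ H` deforms, keeping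
the boundary metric and `scal > 0`, to one which on a collar is `ε²ds² + (1 − 2μ(z)εs − C(εs)²)·h_z`.
Literally `Literature.Geometry.Riemannian.BarHanke2023_thm27_umbilicNormalForm`; closes by `exact` from a
discharge — CLOSED (lead c3, 2026-08-17): the fact is discharged in the tree
(`BarHanke2023_thm27_umbilicNormalForm_holds`, `Literature/Geometry/Riemannian/BaerHankeNormalFormProofs.lean`) and the
stub LANDED as `Summit.SmoothPoincare4.SmoothPoincare4.Theorems.stub_bh27` (p172663). [cite: BarHanke2023, §3 Thm. 27, Def. 21] -/
theorem stub_bh27 : Literature.Geometry.Riemannian.BarHanke2023_thm27_umbilicNormalForm :=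
  Literature.Geometry.Riemannian.BarHanke2023_thm27_umbilicNormalForm_holds

/-- **Stub 2B (derived) — τ-symmetric gluing of simultaneous Bär–Hanke data.**  Formerly registered as a stub,
now a THEOREM: the LANDED conditional `Summit.SmoothPoincare4.SmoothPoincare4.Theorems.stub_symmetricGluingOfBHData_of_bhFacts`
(p162100; inside: Bär–Hanke Prop. 28 strictification, the PROVED λ-selection `exists_contMDiff_invariant_between`, the
PROVED continuity of the tree's mean curvature, Bär–Hanke Thm. 27 on both pieces, and the LANDED τ-equivariant collar
gluing `stub_collarGluing`, p160756) fed with the two fact-stubs `stub_bh28`, `stub_bh27`.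
[cite: BarHanke2023, §3 Thm. 27, Prop. 28] -/
theorem stub_symmetricGluingOfBHData :
    ∀ (C : Type) [TopologicalSpace C] [T2Space C] [SecondCountableTopology C]
    [ChartedSpace (EuclideanHalfSpace 4) C] [IsManifold (𝓡∂ 4) ∞ C] [CompactSpace C]
    [ContractibleSpace C]
    (bC : Literature.Topology.FourManifolds.BoundaryData (𝓡∂ 4) C (𝓡 3))
    (W : Type) [TopologicalSpace W] [T2Space W] [SecondCountableTopology W]
    [ChartedSpace (EuclideanHalfSpace 4) W] [IsManifold (𝓡∂ 4) ∞ W] [CompactSpace W]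
    (bW : Literature.Topology.FourManifolds.BoundaryData (𝓡∂ 4) W (𝓡 3))
    (φ : bC.carrier ≃ₘ⟮𝓡 3, 𝓡 3⟯ bW.carrier) (τ : bC.carrier ≃ₘ⟮𝓡 3, 𝓡 3⟯ bC.carrier),
    Function.Involutive τ →
    ∀ (gC : Literature.Geometry.Lorentzian.PseudoRiemannianMetric (𝓡∂ 4) ∞ (EuclideanSpace ℝ (Fin 4)) (TangentSpace (𝓡∂ 4) : C → Type _))
    [gC.HasLeviCivita] (hfC : gC.IsSpacelikeImmersion (𝓡 3) bC.incl)
    (νC : Literature.Geometry.Lorentzian.NormalField (𝓡∂ 4) bC.incl)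
    (gW : Literature.Geometry.Lorentzian.PseudoRiemannianMetric (𝓡∂ 4) ∞ (EuclideanSpace ℝ (Fin 4)) (TangentSpace (𝓡∂ 4) : W → Type _))
    [gW.HasLeviCivita] (hfW : gW.IsSpacelikeImmersion (𝓡 3) bW.incl)
    (νW : Literature.Geometry.Lorentzian.NormalField (𝓡∂ 4) bW.incl),
    (gC.IsRiemannian ∧ (∀ x, 0 < gC.scalarCurvature x) ∧ gC.IsUnitNormal (𝓡 3) bC.incl νC 1 ∧
      ContMDiff (𝓡 3) (𝓡∂ 4).tangent ∞ (fun z ↦ (Bundle.TotalSpace.mk' (EuclideanSpace ℝ (Fin 4)) (bC.incl z) (νC z) : TangentBundle (𝓡∂ 4) C)) ∧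
      (∀ z, (show EuclideanSpace ℝ (Fin 4) from νC z) 0 < 0)) →
    (gW.IsRiemannian ∧ (∀ x, 0 < gW.scalarCurvature x) ∧ gW.IsUnitNormal (𝓡 3) bW.incl νW 1 ∧
      ContMDiff (𝓡 3) (𝓡∂ 4).tangent ∞ (fun w ↦ (Bundle.TotalSpace.mk' (EuclideanSpace ℝ (Fin 4)) (bW.incl w) (νW w) : TangentBundle (𝓡∂ 4) W)) ∧
      (∀ w, (show EuclideanSpace ℝ (Fin 4) from νW w) 0 < 0)) →
    (∀ z, Literature.Geometry.Lorentzian.pullbackBilin (I := 𝓡∂ 4) (I' := 𝓡 3) bC.incl gC.val z =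
      Literature.Geometry.Lorentzian.pullbackBilin (I := 𝓡∂ 4) (I' := 𝓡 3) (bW.incl ∘ φ) gW.val z) →
    (∀ z, Literature.Geometry.Lorentzian.pullbackBilin (I := 𝓡∂ 4) (I' := 𝓡 3) bC.incl gC.val z =
      Literature.Geometry.Lorentzian.pullbackBilin (I := 𝓡∂ 4) (I' := 𝓡 3) (bW.incl ∘ φ ∘ τ) gW.val z) →
    (∀ z, 0 ≤ gC.meanCurvature bC.incl Literature.Geometry.Lorentzian.PseudoRiemannianMetric.contMDiff_pullbackBilin_holds hfC νC z +
      gW.meanCurvature bW.incl Literature.Geometry.Lorentzian.PseudoRiemannianMetric.contMDiff_pullbackBilin_holds hfW νW (φ z)) →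
    (∀ z, 0 ≤ gC.meanCurvature bC.incl Literature.Geometry.Lorentzian.PseudoRiemannianMetric.contMDiff_pullbackBilin_holds hfC νC z +
      gW.meanCurvature bW.incl Literature.Geometry.Lorentzian.PseudoRiemannianMetric.contMDiff_pullbackBilin_holds hfW νW (φ (τ z))) →
    ∃ (P : Type) (_ : TopologicalSpace P) (_ : T2Space P) (_ : SecondCountableTopology P)
    (_ : ChartedSpace (EuclideanSpace ℝ (Fin 4)) P) (_ : IsManifold (𝓡 4) ∞ P),
    ∃ (jC : C → P) (jW : W → P),
    (Manifold.IsSmoothEmbedding (𝓡∂ 4) (𝓡 4) ∞ jC ∧ Manifold.IsSmoothEmbedding (𝓡∂ 4) (𝓡 4) ∞ jW ∧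
      Set.range jC ∪ Set.range jW = Set.univ ∧
      (∀ a b, jC a = jW b ↔ ∃ z, a = bC.incl z ∧ b = bW.incl (φ z))) ∧
    ∃ (g : Literature.Geometry.Lorentzian.PseudoRiemannianMetric (𝓡 4) ∞ (EuclideanSpace ℝ (Fin 4)) (TangentSpace (𝓡 4) : P → Type _))
    (U : Set P) (T : P → P),
      g.IsRiemannian ∧ (∃ _ : g.HasLeviCivita, ∀ x, 0 < g.scalarCurvature x) ∧
      IsOpen U ∧ (∀ z, jC (bC.incl z) ∈ U) ∧ ContMDiffOn (𝓡 4) (𝓡 4) ∞ T U ∧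
      (∀ x ∈ U, T x ∈ U) ∧ (∀ x ∈ U, T (T x) = x) ∧
      (∀ x ∈ U, (T x ∈ Set.range jC ↔ x ∈ Set.range jC)) ∧
      (∀ z, T (jC (bC.incl z)) = jC (bC.incl (τ z))) ∧
      (∀ x ∈ U, Literature.Geometry.Lorentzian.pullbackBilin (I := 𝓡 4) (I' := 𝓡 4) T g.val x = g.val x) :=
  _root_.Summit.SmoothPoincare4.SmoothPoincare4.Theorems.stub_symmetricGluingOfBHData_of_bhFacts
    stub_bh28 stub_bh27

/-- **Stub 2T — transport of a τ-symmetric PSC germ along gluing uniqueness (M, provable now).**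
If `P` is a gluing `C ∪_φ W` (explicit `jC, jW`) carrying `(g, U, T)` as in `stub_symmetricGluingOfBHData`,
and the standard `S⁴` is also a gluing `C ∪_φ W`, then `S⁴` carries piece embeddings `jC', jW'` (again a
gluing witness for `φ`) and `(g', U', T')` with the same properties.  Proof: `F : P ≅ S⁴` by gluing
uniqueness (`Literature.Topology.FourManifolds.nonempty_diffeomorph_of_isBoundaryGluing_holds`, PROVED;
Hirsch Ch. 8 §2 Thm. 2.1); `jC' := F ∘ jC`, `jW' := F ∘ jW`, `g' := (F⁻¹)^* g`
(`PseudoRiemannianMetric.comap`, keeps Levi-Civita, Riemannian-ness and `scal`: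
`Literature.Geometry.Riemannian.exists_pscMetric_of_diffeomorph` / `scalarCurvature_comap`),
`U' := F.symm ⁻¹' U`, `T' := F ∘ T ∘ F⁻¹`; all clauses by the chain rule (`pullbackBilin_comp`), as in the
landed `Summit.SmoothPoincare4.SmoothPoincare4.Theorems.stub_isometricTransport`.
[cite: HirschDT1976, Ch. 8 §2 Thm. 2.1; ONeill1983, Ch. 3 Prop. 3.59] -/
theorem stub_transportSymmetricGerm :
    ∀ (C : Type) [TopologicalSpace C] [T2Space C] [SecondCountableTopology C]
    [ChartedSpace (EuclideanHalfSpace 4) C] [IsManifold (𝓡∂ 4) ∞ C] [CompactSpace C]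
    [ContractibleSpace C]
    (bC : Literature.Topology.FourManifolds.BoundaryData (𝓡∂ 4) C (𝓡 3))
    (W : Type) [TopologicalSpace W] [T2Space W] [SecondCountableTopology W]
    [ChartedSpace (EuclideanHalfSpace 4) W] [IsManifold (𝓡∂ 4) ∞ W] [CompactSpace W]
    (bW : Literature.Topology.FourManifolds.BoundaryData (𝓡∂ 4) W (𝓡 3))
    (φ : bC.carrier ≃ₘ⟮𝓡 3, 𝓡 3⟯ bW.carrier) (τ : bC.carrier ≃ₘ⟮𝓡 3, 𝓡 3⟯ bC.carrier)
    (P : Type) [TopologicalSpace P] [T2Space P] [SecondCountableTopology P]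
    [ChartedSpace (EuclideanSpace ℝ (Fin 4)) P] [IsManifold (𝓡 4) ∞ P]
    (jC : C → P) (jW : W → P)
    (g : Literature.Geometry.Lorentzian.PseudoRiemannianMetric (𝓡 4) ∞ (EuclideanSpace ℝ (Fin 4)) (TangentSpace (𝓡 4) : P → Type _))
    (U : Set P) (T : P → P),
    Function.Involutive τ →
    Manifold.IsSmoothEmbedding (𝓡∂ 4) (𝓡 4) ∞ jC ∧ Manifold.IsSmoothEmbedding (𝓡∂ 4) (𝓡 4) ∞ jW ∧
      Set.range jC ∪ Set.range jW = Set.univ ∧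
      (∀ a b, jC a = jW b ↔ ∃ z, a = bC.incl z ∧ b = bW.incl (φ z)) →
    g.IsRiemannian ∧ (∃ _ : g.HasLeviCivita, ∀ x, 0 < g.scalarCurvature x) ∧
      IsOpen U ∧ (∀ z, jC (bC.incl z) ∈ U) ∧ ContMDiffOn (𝓡 4) (𝓡 4) ∞ T U ∧
      (∀ x ∈ U, T x ∈ U) ∧ (∀ x ∈ U, T (T x) = x) ∧
      (∀ x ∈ U, (T x ∈ Set.range jC ↔ x ∈ Set.range jC)) ∧
      (∀ z, T (jC (bC.incl z)) = jC (bC.incl (τ z))) ∧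
      (∀ x ∈ U, Literature.Geometry.Lorentzian.pullbackBilin (I := 𝓡 4) (I' := 𝓡 4) T g.val x = g.val x) →
    Literature.Topology.FourManifolds.IsBoundaryGluing bC bW φ (𝓡 4) (Metric.sphere (0 : EuclideanSpace ℝ (Fin 5)) 1) →
    ∃ (jC : C → (Metric.sphere (0 : EuclideanSpace ℝ (Fin 5)) 1)) (jW : W → (Metric.sphere (0 : EuclideanSpace ℝ (Fin 5)) 1)),
    (Manifold.IsSmoothEmbedding (𝓡∂ 4) (𝓡 4) ∞ jC ∧ Manifold.IsSmoothEmbedding (𝓡∂ 4) (𝓡 4) ∞ jW ∧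
      Set.range jC ∪ Set.range jW = Set.univ ∧
      (∀ a b, jC a = jW b ↔ ∃ z, a = bC.incl z ∧ b = bW.incl (φ z))) ∧
    ∃ (g : Literature.Geometry.Lorentzian.PseudoRiemannianMetric (𝓡 4) ∞ (EuclideanSpace ℝ (Fin 4)) (TangentSpace (𝓡 4) : (Metric.sphere (0 : EuclideanSpace ℝ (Fin 5)) 1) → Type _))
    (U : Set (Metric.sphere (0 : EuclideanSpace ℝ (Fin 5)) 1)) (T : (Metric.sphere (0 : EuclideanSpace ℝ (Fin 5)) 1) → (Metric.sphere (0 : EuclideanSpace ℝ (Fin 5)) 1)),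
      g.IsRiemannian ∧ (∃ _ : g.HasLeviCivita, ∀ x, 0 < g.scalarCurvature x) ∧
      IsOpen U ∧ (∀ z, jC (bC.incl z) ∈ U) ∧ ContMDiffOn (𝓡 4) (𝓡 4) ∞ T U ∧
      (∀ x ∈ U, T x ∈ U) ∧ (∀ x ∈ U, T (T x) = x) ∧
      (∀ x ∈ U, (T x ∈ Set.range jC ↔ x ∈ Set.range jC)) ∧
      (∀ z, T (jC (bC.incl z)) = jC (bC.incl (τ z))) ∧
      (∀ x ∈ U, Literature.Geometry.Lorentzian.pullbackBilin (I := 𝓡 4) (I' := 𝓡 4) T g.val x = g.val x) :=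
  _root_.Summit.SmoothPoincare4.SmoothPoincare4.Theorems.stub_transportSymmetricGerm

/-- **Stub 2 (derived) — τ-symmetric PSC germ on the standard sphere, with CHOSEN piece embeddings.**
For an involutive cork presentation `S⁴ = C ∪_φ W`, `Σ = C ∪_(φ∘τ) W`: piece embeddings `jC, jW` of `S⁴`
(a gluing witness for `φ`), a Riemannian PSC metric `g` on `S⁴` and `(U, T)` — an isometric, involutive,
side-preserving extension of `τ` to a neighbourhood of the seam.  Sorry-free composition of stubs 2A, 2B, 2T.
[folklore] -/
theorem symmetricPscGerm_of_stubs :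
    ∀ (C : Type) [TopologicalSpace C] [T2Space C] [SecondCountableTopology C]
    [ChartedSpace (EuclideanHalfSpace 4) C] [IsManifold (𝓡∂ 4) ∞ C] [CompactSpace C]
    [ContractibleSpace C]
    (bC : Literature.Topology.FourManifolds.BoundaryData (𝓡∂ 4) C (𝓡 3))
    (W : Type) [TopologicalSpace W] [T2Space W] [SecondCountableTopology W]
    [ChartedSpace (EuclideanHalfSpace 4) W] [IsManifold (𝓡∂ 4) ∞ W] [CompactSpace W]
    (bW : Literature.Topology.FourManifolds.BoundaryData (𝓡∂ 4) W (𝓡 3))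
    (φ : bC.carrier ≃ₘ⟮𝓡 3, 𝓡 3⟯ bW.carrier) (τ : bC.carrier ≃ₘ⟮𝓡 3, 𝓡 3⟯ bC.carrier),
    Function.Involutive τ →
    Literature.Topology.FourManifolds.IsBoundaryGluing bC bW φ (𝓡 4) (Metric.sphere (0 : EuclideanSpace ℝ (Fin 5)) 1) →
    (∀ S : Literature.Topology.FourManifolds.HomotopySphere 4,
      Literature.Topology.FourManifolds.IsBoundaryGluing bC bW (τ.trans φ) (𝓡 4) S.carrier →
    ∃ (jC : C → (Metric.sphere (0 : EuclideanSpace ℝ (Fin 5)) 1)) (jW : W → (Metric.sphere (0 : EuclideanSpace ℝ (Fin 5)) 1)),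
    (Manifold.IsSmoothEmbedding (𝓡∂ 4) (𝓡 4) ∞ jC ∧ Manifold.IsSmoothEmbedding (𝓡∂ 4) (𝓡 4) ∞ jW ∧
      Set.range jC ∪ Set.range jW = Set.univ ∧
      (∀ a b, jC a = jW b ↔ ∃ z, a = bC.incl z ∧ b = bW.incl (φ z))) ∧
    ∃ (g : Literature.Geometry.Lorentzian.PseudoRiemannianMetric (𝓡 4) ∞ (EuclideanSpace ℝ (Fin 4)) (TangentSpace (𝓡 4) : (Metric.sphere (0 : EuclideanSpace ℝ (Fin 5)) 1) → Type _))
    (U : Set (Metric.sphere (0 : EuclideanSpace ℝ (Fin 5)) 1)) (T : (Metric.sphere (0 : EuclideanSpace ℝ (Fin 5)) 1) → (Metric.sphere (0 : EuclideanSpace ℝ (Fin 5)) 1)),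
      g.IsRiemannian ∧ (∃ _ : g.HasLeviCivita, ∀ x, 0 < g.scalarCurvature x) ∧
      IsOpen U ∧ (∀ z, jC (bC.incl z) ∈ U) ∧ ContMDiffOn (𝓡 4) (𝓡 4) ∞ T U ∧
      (∀ x ∈ U, T x ∈ U) ∧ (∀ x ∈ U, T (T x) = x) ∧
      (∀ x ∈ U, (T x ∈ Set.range jC ↔ x ∈ Set.range jC)) ∧
      (∀ z, T (jC (bC.incl z)) = jC (bC.incl (τ z))) ∧
      (∀ x ∈ U, Literature.Geometry.Lorentzian.pullbackBilin (I := 𝓡 4) (I' := 𝓡 4) T g.val x = g.val x)) := by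
  intro C _ _ _ _ _ _ _ bC W _ _ _ _ _ _ bW φ τ hτ hS4 S hSig
  obtain ⟨gC, hLC, hfC, νC, gW, hLW, hfW, νW, hC, hW, hmet, hmetτ, hH, hHτ⟩ :=
    stub_simultaneousBHData C bC W bW φ τ hτ hS4 S hSig
  obtain ⟨P, _, _, _, _, _, jC, jW, hwit, g, U, T, hsym⟩ :=
    stub_symmetricGluingOfBHData C bC W bW φ τ hτ gC hfC νC gW hfW νW hC hW hmet hmetτ hH hHτ
  exact stub_transportSymmetricGerm C bC W bW φ τ P jC jW g U T hτ hwit hsym hS4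

/-- **Stub 3 — isometric regluing along a germ isometry (differential topology, M/L).**
Given the splitting `S⁴ = C ∪_φ W` (`jC, jW`), a Riemannian metric `g` on `S⁴`, an open `U ⊇ jC(∂C)` and
`T` smooth, involutive, side-preserving and `g`-isometric on `U` with `T ∘ jC ∘ incl = jC ∘ incl ∘ τ`
(`τ` an involution of `∂C`), there is a Hausdorff second-countable smooth 4-manifold `X` which is the
gluing `C ∪_(φ∘τ) W` (piece embeddings `kC, kW`, seam relation for `τ.trans φ`) carrying a Riemannian `γ`
with `jC^* g = kC^* γ` and `jW^* g = kW^* γ`.  Construction: the OPEN gluing of `jC(C) ∪ U` and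
`S⁴ ∖ jC(C)` along `T|(U ∖ jC C)` (Hausdorff because `T(Y) = Y`), `γ = g ⊔ g`, `kC = [jC]`,
`kW = [jW]` resp. `[T ∘ jW]` near `∂W`.  Sources: HirschDT1976 (Ch. 8 §2), BrockerJanich1982 (§13),
ONeill1983 (Ch. 3, p. 58, 90–91); tree: `IsOpenGluing`, `OpenGluingIsManifold`. -/
theorem stub_isometricRegluing :
    ∀ (C : Type) [TopologicalSpace C] [T2Space C] [SecondCountableTopology C]
    [ChartedSpace (EuclideanHalfSpace 4) C] [IsManifold (𝓡∂ 4) ∞ C] [CompactSpace C]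
    (bC : Literature.Topology.FourManifolds.BoundaryData (𝓡∂ 4) C (𝓡 3))
    (W : Type) [TopologicalSpace W] [T2Space W] [SecondCountableTopology W]
    [ChartedSpace (EuclideanHalfSpace 4) W] [IsManifold (𝓡∂ 4) ∞ W] [CompactSpace W]
    (bW : Literature.Topology.FourManifolds.BoundaryData (𝓡∂ 4) W (𝓡 3))
    (φ : bC.carrier ≃ₘ⟮𝓡 3, 𝓡 3⟯ bW.carrier) (τ : bC.carrier ≃ₘ⟮𝓡 3, 𝓡 3⟯ bC.carrier)
    (jC : C → (Metric.sphere (0 : EuclideanSpace ℝ (Fin 5)) 1))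
    (jW : W → (Metric.sphere (0 : EuclideanSpace ℝ (Fin 5)) 1))
    (g : Literature.Geometry.Lorentzian.PseudoRiemannianMetric (𝓡 4) ∞ (EuclideanSpace ℝ (Fin 4)) (TangentSpace (𝓡 4) : (Metric.sphere (0 : EuclideanSpace ℝ (Fin 5)) 1) → Type _))
    (U : Set (Metric.sphere (0 : EuclideanSpace ℝ (Fin 5)) 1))
    (T : (Metric.sphere (0 : EuclideanSpace ℝ (Fin 5)) 1) → (Metric.sphere (0 : EuclideanSpace ℝ (Fin 5)) 1)),
    Function.Involutive τ →
    Manifold.IsSmoothEmbedding (𝓡∂ 4) (𝓡 4) ∞ jC → Manifold.IsSmoothEmbedding (𝓡∂ 4) (𝓡 4) ∞ jW →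
    Set.range jC ∪ Set.range jW = Set.univ →
    (∀ a b, jC a = jW b ↔ ∃ z, a = bC.incl z ∧ b = bW.incl (φ z)) →
    g.IsRiemannian →
    IsOpen U → (∀ z, jC (bC.incl z) ∈ U) → ContMDiffOn (𝓡 4) (𝓡 4) ∞ T U →
    (∀ x ∈ U, T x ∈ U) → (∀ x ∈ U, T (T x) = x) →
    (∀ x ∈ U, (T x ∈ Set.range jC ↔ x ∈ Set.range jC)) →
    (∀ z, T (jC (bC.incl z)) = jC (bC.incl (τ z))) →
    (∀ x ∈ U, Literature.Geometry.Lorentzian.pullbackBilin (I := 𝓡 4) (I' := 𝓡 4) T g.val x = g.val x) →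
    ∃ (X : Type) (_ : TopologicalSpace X) (_ : T2Space X) (_ : SecondCountableTopology X)
    (_ : ChartedSpace (EuclideanSpace ℝ (Fin 4)) X) (_ : IsManifold (𝓡 4) ∞ X)
    (kC : C → X) (kW : W → X)
    (γ : Literature.Geometry.Lorentzian.PseudoRiemannianMetric (𝓡 4) ∞ (EuclideanSpace ℝ (Fin 4)) (TangentSpace (𝓡 4) : X → Type _)),
    Manifold.IsSmoothEmbedding (𝓡∂ 4) (𝓡 4) ∞ kC ∧ Manifold.IsSmoothEmbedding (𝓡∂ 4) (𝓡 4) ∞ kW ∧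
    Set.range kC ∪ Set.range kW = Set.univ ∧
    (∀ a b, kC a = kW b ↔ ∃ z, a = bC.incl z ∧ b = bW.incl ((τ.trans φ) z)) ∧
    γ.IsRiemannian ∧
    (∀ c, Literature.Geometry.Lorentzian.pullbackBilin (I := 𝓡 4) (I' := 𝓡∂ 4) jC g.val c =
    Literature.Geometry.Lorentzian.pullbackBilin (I := 𝓡 4) (I' := 𝓡∂ 4) kC γ.val c) ∧
    (∀ w, Literature.Geometry.Lorentzian.pullbackBilin (I := 𝓡 4) (I' := 𝓡∂ 4) jW g.val w =
    Literature.Geometry.Lorentzian.pullbackBilin (I := 𝓡 4) (I' := 𝓡∂ 4) kW γ.val w) :=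
  _root_.Summit.SmoothPoincare4.SmoothPoincare4.Theorems.stub_isometricRegluing

/-- **Stub 4 — isometric transport along gluing uniqueness (M, provable now).**
If `X` (with explicit piece embeddings `kC, kW` and a Riemannian metric `γ`) and `X'` are both the gluing
`C ∪_ψ W` of the same compact pieces along the same `ψ : ∂C ≅ ∂W`, then `X'` carries piece embeddings
`kC', kW'` (again a gluing witness for `ψ`) and a Riemannian `γ'` with `kC'^* γ' = kC^* γ`,
`kW'^* γ' = kW^* γ`.  Proof sketch: `F : X ≅ X'` by gluing uniqueness (Hirsch Ch. 8 Thm. 2.1 =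
`Literature.Topology.FourManifolds.nonempty_diffeomorph_of_isBoundaryGluing_holds`, PROVED), `kC' := F ∘ kC`,
`kW' := F ∘ kW`, `γ' := (F.symm)^* γ` (`PseudoRiemannianMetric.comap`), and `pullbackBilin_comp`.
Sources: HirschDT1976 (Ch. 8 §2 Thm. 2.1), BrockerJanich1982 ((13.9)), ONeill1983 (Ch. 3 p. 58). -/
theorem stub_isometricTransport :
    ∀ (C : Type) [TopologicalSpace C] [T2Space C] [SecondCountableTopology C]
    [ChartedSpace (EuclideanHalfSpace 4) C] [IsManifold (𝓡∂ 4) ∞ C] [CompactSpace C]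
    (bC : Literature.Topology.FourManifolds.BoundaryData (𝓡∂ 4) C (𝓡 3))
    (W : Type) [TopologicalSpace W] [T2Space W] [SecondCountableTopology W]
    [ChartedSpace (EuclideanHalfSpace 4) W] [IsManifold (𝓡∂ 4) ∞ W] [CompactSpace W]
    (bW : Literature.Topology.FourManifolds.BoundaryData (𝓡∂ 4) W (𝓡 3))
    (ψ : bC.carrier ≃ₘ⟮𝓡 3, 𝓡 3⟯ bW.carrier)
    (X : Type) [TopologicalSpace X] [T2Space X] [SecondCountableTopology X]
    [ChartedSpace (EuclideanSpace ℝ (Fin 4)) X] [IsManifold (𝓡 4) ∞ X]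
    (X' : Type) [TopologicalSpace X'] [T2Space X'] [SecondCountableTopology X']
    [ChartedSpace (EuclideanSpace ℝ (Fin 4)) X'] [IsManifold (𝓡 4) ∞ X']
    (kC : C → X) (kW : W → X)
    (γ : Literature.Geometry.Lorentzian.PseudoRiemannianMetric (𝓡 4) ∞ (EuclideanSpace ℝ (Fin 4)) (TangentSpace (𝓡 4) : X → Type _)),
    Manifold.IsSmoothEmbedding (𝓡∂ 4) (𝓡 4) ∞ kC → Manifold.IsSmoothEmbedding (𝓡∂ 4) (𝓡 4) ∞ kW →
    Set.range kC ∪ Set.range kW = Set.univ →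
    (∀ a b, kC a = kW b ↔ ∃ z, a = bC.incl z ∧ b = bW.incl (ψ z)) →
    γ.IsRiemannian →
    Literature.Topology.FourManifolds.IsBoundaryGluing bC bW ψ (𝓡 4) X' →
    ∃ (kC' : C → X') (kW' : W → X')
    (γ' : Literature.Geometry.Lorentzian.PseudoRiemannianMetric (𝓡 4) ∞ (EuclideanSpace ℝ (Fin 4)) (TangentSpace (𝓡 4) : X' → Type _)),
    Manifold.IsSmoothEmbedding (𝓡∂ 4) (𝓡 4) ∞ kC' ∧ Manifold.IsSmoothEmbedding (𝓡∂ 4) (𝓡 4) ∞ kW' ∧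
    Set.range kC' ∪ Set.range kW' = Set.univ ∧
    (∀ a b, kC' a = kW' b ↔ ∃ z, a = bC.incl z ∧ b = bW.incl (ψ z)) ∧
    γ'.IsRiemannian ∧
    (∀ c, Literature.Geometry.Lorentzian.pullbackBilin (I := 𝓡 4) (I' := 𝓡∂ 4) kC' γ'.val c =
    Literature.Geometry.Lorentzian.pullbackBilin (I := 𝓡 4) (I' := 𝓡∂ 4) kC γ.val c) ∧
    (∀ w, Literature.Geometry.Lorentzian.pullbackBilin (I := 𝓡 4) (I' := 𝓡∂ 4) kW' γ'.val w =
    Literature.Geometry.Lorentzian.pullbackBilin (I := 𝓡 4) (I' := 𝓡∂ 4) kW γ.val w) :=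
  _root_.Summit.SmoothPoincare4.SmoothPoincare4.Theorems.stub_isometricTransport

/-! ## The composition (sorry-free): the four statements imply the crux -/

/-- **The four stub statements imply `CorkRegluablePsc`, pointwise in the homotopy sphere** — the real
assembly of the line (pure logic plus `BoundaryData.range_incl` for the two "seam ⇒ boundary" clauses and
transitivity of the piece-metric identities).  The conclusion is the crux's body for the given `S`,
verbatim. [folklore] -/
theorem corkRegluablePsc_of_stubSigs
    (h1 : ∀ S : Literature.Topology.FourManifolds.HomotopySphere 4, ∃ (C : Type) (_ : TopologicalSpace C) (_ : T2Space C)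
      (_ : SecondCountableTopology C) (_ : ChartedSpace (EuclideanHalfSpace 4) C)
      (_ : IsManifold (𝓡∂ 4) ∞ C) (_ : CompactSpace C) (_ : ContractibleSpace C)
      (bC : Literature.Topology.FourManifolds.BoundaryData (𝓡∂ 4) C (𝓡 3))
      (W : Type) (_ : TopologicalSpace W) (_ : T2Space W) (_ : SecondCountableTopology W)
      (_ : ChartedSpace (EuclideanHalfSpace 4) W) (_ : IsManifold (𝓡∂ 4) ∞ W) (_ : CompactSpace W)
      (bW : Literature.Topology.FourManifolds.BoundaryData (𝓡∂ 4) W (𝓡 3))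
      (φ : bC.carrier ≃ₘ⟮𝓡 3, 𝓡 3⟯ bW.carrier) (τ : bC.carrier ≃ₘ⟮𝓡 3, 𝓡 3⟯ bC.carrier),
      Function.Involutive τ ∧
      Literature.Topology.FourManifolds.IsBoundaryGluing bC bW φ (𝓡 4) (Metric.sphere (0 : EuclideanSpace ℝ (Fin 5)) 1) ∧
      Literature.Topology.FourManifolds.IsBoundaryGluing bC bW (τ.trans φ) (𝓡 4) S.carrier)
    (h2 : ∀ (C : Type) [TopologicalSpace C] [T2Space C] [SecondCountableTopology C]
    [ChartedSpace (EuclideanHalfSpace 4) C] [IsManifold (𝓡∂ 4) ∞ C] [CompactSpace C]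
    [ContractibleSpace C]
    (bC : Literature.Topology.FourManifolds.BoundaryData (𝓡∂ 4) C (𝓡 3))
    (W : Type) [TopologicalSpace W] [T2Space W] [SecondCountableTopology W]
    [ChartedSpace (EuclideanHalfSpace 4) W] [IsManifold (𝓡∂ 4) ∞ W] [CompactSpace W]
    (bW : Literature.Topology.FourManifolds.BoundaryData (𝓡∂ 4) W (𝓡 3))
    (φ : bC.carrier ≃ₘ⟮𝓡 3, 𝓡 3⟯ bW.carrier) (τ : bC.carrier ≃ₘ⟮𝓡 3, 𝓡 3⟯ bC.carrier),
      Function.Involutive τ →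
      Literature.Topology.FourManifolds.IsBoundaryGluing bC bW φ (𝓡 4) (Metric.sphere (0 : EuclideanSpace ℝ (Fin 5)) 1) →
      (∀ S : Literature.Topology.FourManifolds.HomotopySphere 4,
        Literature.Topology.FourManifolds.IsBoundaryGluing bC bW (τ.trans φ) (𝓡 4) S.carrier →
    ∃ (jC : C → (Metric.sphere (0 : EuclideanSpace ℝ (Fin 5)) 1)) (jW : W → (Metric.sphere (0 : EuclideanSpace ℝ (Fin 5)) 1)),
    (Manifold.IsSmoothEmbedding (𝓡∂ 4) (𝓡 4) ∞ jC ∧ Manifold.IsSmoothEmbedding (𝓡∂ 4) (𝓡 4) ∞ jW ∧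
      Set.range jC ∪ Set.range jW = Set.univ ∧
      (∀ a b, jC a = jW b ↔ ∃ z, a = bC.incl z ∧ b = bW.incl (φ z))) ∧
    ∃ (g : Literature.Geometry.Lorentzian.PseudoRiemannianMetric (𝓡 4) ∞ (EuclideanSpace ℝ (Fin 4)) (TangentSpace (𝓡 4) : (Metric.sphere (0 : EuclideanSpace ℝ (Fin 5)) 1) → Type _))
    (U : Set (Metric.sphere (0 : EuclideanSpace ℝ (Fin 5)) 1)) (T : (Metric.sphere (0 : EuclideanSpace ℝ (Fin 5)) 1) → (Metric.sphere (0 : EuclideanSpace ℝ (Fin 5)) 1)),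
      g.IsRiemannian ∧ (∃ _ : g.HasLeviCivita, ∀ x, 0 < g.scalarCurvature x) ∧
      IsOpen U ∧ (∀ z, jC (bC.incl z) ∈ U) ∧ ContMDiffOn (𝓡 4) (𝓡 4) ∞ T U ∧
      (∀ x ∈ U, T x ∈ U) ∧ (∀ x ∈ U, T (T x) = x) ∧
      (∀ x ∈ U, (T x ∈ Set.range jC ↔ x ∈ Set.range jC)) ∧
      (∀ z, T (jC (bC.incl z)) = jC (bC.incl (τ z))) ∧
      (∀ x ∈ U, Literature.Geometry.Lorentzian.pullbackBilin (I := 𝓡 4) (I' := 𝓡 4) T g.val x = g.val x)))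
    (h3 : ∀ (C : Type) [TopologicalSpace C] [T2Space C] [SecondCountableTopology C]
      [ChartedSpace (EuclideanHalfSpace 4) C] [IsManifold (𝓡∂ 4) ∞ C] [CompactSpace C]
      (bC : Literature.Topology.FourManifolds.BoundaryData (𝓡∂ 4) C (𝓡 3))
      (W : Type) [TopologicalSpace W] [T2Space W] [SecondCountableTopology W]
      [ChartedSpace (EuclideanHalfSpace 4) W] [IsManifold (𝓡∂ 4) ∞ W] [CompactSpace W]
      (bW : Literature.Topology.FourManifolds.BoundaryData (𝓡∂ 4) W (𝓡 3))
      (φ : bC.carrier ≃ₘ⟮𝓡 3, 𝓡 3⟯ bW.carrier) (τ : bC.carrier ≃ₘ⟮𝓡 3, 𝓡 3⟯ bC.carrier)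
      (jC : C → (Metric.sphere (0 : EuclideanSpace ℝ (Fin 5)) 1))
      (jW : W → (Metric.sphere (0 : EuclideanSpace ℝ (Fin 5)) 1))
      (g : Literature.Geometry.Lorentzian.PseudoRiemannianMetric (𝓡 4) ∞ (EuclideanSpace ℝ (Fin 4)) (TangentSpace (𝓡 4) : (Metric.sphere (0 : EuclideanSpace ℝ (Fin 5)) 1) → Type _))
      (U : Set (Metric.sphere (0 : EuclideanSpace ℝ (Fin 5)) 1))
      (T : (Metric.sphere (0 : EuclideanSpace ℝ (Fin 5)) 1) → (Metric.sphere (0 : EuclideanSpace ℝ (Fin 5)) 1)),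
      Function.Involutive τ →
      Manifold.IsSmoothEmbedding (𝓡∂ 4) (𝓡 4) ∞ jC → Manifold.IsSmoothEmbedding (𝓡∂ 4) (𝓡 4) ∞ jW →
      Set.range jC ∪ Set.range jW = Set.univ →
      (∀ a b, jC a = jW b ↔ ∃ z, a = bC.incl z ∧ b = bW.incl (φ z)) →
      g.IsRiemannian →
      IsOpen U → (∀ z, jC (bC.incl z) ∈ U) → ContMDiffOn (𝓡 4) (𝓡 4) ∞ T U →
      (∀ x ∈ U, T x ∈ U) → (∀ x ∈ U, T (T x) = x) →
      (∀ x ∈ U, (T x ∈ Set.range jC ↔ x ∈ Set.range jC)) →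
      (∀ z, T (jC (bC.incl z)) = jC (bC.incl (τ z))) →
      (∀ x ∈ U, Literature.Geometry.Lorentzian.pullbackBilin (I := 𝓡 4) (I' := 𝓡 4) T g.val x = g.val x) →
      ∃ (X : Type) (_ : TopologicalSpace X) (_ : T2Space X) (_ : SecondCountableTopology X)
      (_ : ChartedSpace (EuclideanSpace ℝ (Fin 4)) X) (_ : IsManifold (𝓡 4) ∞ X)
      (kC : C → X) (kW : W → X)
      (γ : Literature.Geometry.Lorentzian.PseudoRiemannianMetric (𝓡 4) ∞ (EuclideanSpace ℝ (Fin 4)) (TangentSpace (𝓡 4) : X → Type _)),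
      Manifold.IsSmoothEmbedding (𝓡∂ 4) (𝓡 4) ∞ kC ∧ Manifold.IsSmoothEmbedding (𝓡∂ 4) (𝓡 4) ∞ kW ∧
      Set.range kC ∪ Set.range kW = Set.univ ∧
      (∀ a b, kC a = kW b ↔ ∃ z, a = bC.incl z ∧ b = bW.incl ((τ.trans φ) z)) ∧
      γ.IsRiemannian ∧
      (∀ c, Literature.Geometry.Lorentzian.pullbackBilin (I := 𝓡 4) (I' := 𝓡∂ 4) jC g.val c =
      Literature.Geometry.Lorentzian.pullbackBilin (I := 𝓡 4) (I' := 𝓡∂ 4) kC γ.val c) ∧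
      (∀ w, Literature.Geometry.Lorentzian.pullbackBilin (I := 𝓡 4) (I' := 𝓡∂ 4) jW g.val w =
      Literature.Geometry.Lorentzian.pullbackBilin (I := 𝓡 4) (I' := 𝓡∂ 4) kW γ.val w))
    (h4 : ∀ (C : Type) [TopologicalSpace C] [T2Space C] [SecondCountableTopology C]
      [ChartedSpace (EuclideanHalfSpace 4) C] [IsManifold (𝓡∂ 4) ∞ C] [CompactSpace C]
      (bC : Literature.Topology.FourManifolds.BoundaryData (𝓡∂ 4) C (𝓡 3))
      (W : Type) [TopologicalSpace W] [T2Space W] [SecondCountableTopology W]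
      [ChartedSpace (EuclideanHalfSpace 4) W] [IsManifold (𝓡∂ 4) ∞ W] [CompactSpace W]
      (bW : Literature.Topology.FourManifolds.BoundaryData (𝓡∂ 4) W (𝓡 3))
      (ψ : bC.carrier ≃ₘ⟮𝓡 3, 𝓡 3⟯ bW.carrier)
      (X : Type) [TopologicalSpace X] [T2Space X] [SecondCountableTopology X]
      [ChartedSpace (EuclideanSpace ℝ (Fin 4)) X] [IsManifold (𝓡 4) ∞ X]
      (X' : Type) [TopologicalSpace X'] [T2Space X'] [SecondCountableTopology X']
      [ChartedSpace (EuclideanSpace ℝ (Fin 4)) X'] [IsManifold (𝓡 4) ∞ X']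
      (kC : C → X) (kW : W → X)
      (γ : Literature.Geometry.Lorentzian.PseudoRiemannianMetric (𝓡 4) ∞ (EuclideanSpace ℝ (Fin 4)) (TangentSpace (𝓡 4) : X → Type _)),
      Manifold.IsSmoothEmbedding (𝓡∂ 4) (𝓡 4) ∞ kC → Manifold.IsSmoothEmbedding (𝓡∂ 4) (𝓡 4) ∞ kW →
      Set.range kC ∪ Set.range kW = Set.univ →
      (∀ a b, kC a = kW b ↔ ∃ z, a = bC.incl z ∧ b = bW.incl (ψ z)) →
      γ.IsRiemannian →
      Literature.Topology.FourManifolds.IsBoundaryGluing bC bW ψ (𝓡 4) X' →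
      ∃ (kC' : C → X') (kW' : W → X')
      (γ' : Literature.Geometry.Lorentzian.PseudoRiemannianMetric (𝓡 4) ∞ (EuclideanSpace ℝ (Fin 4)) (TangentSpace (𝓡 4) : X' → Type _)),
      Manifold.IsSmoothEmbedding (𝓡∂ 4) (𝓡 4) ∞ kC' ∧ Manifold.IsSmoothEmbedding (𝓡∂ 4) (𝓡 4) ∞ kW' ∧
      Set.range kC' ∪ Set.range kW' = Set.univ ∧
      (∀ a b, kC' a = kW' b ↔ ∃ z, a = bC.incl z ∧ b = bW.incl (ψ z)) ∧
      γ'.IsRiemannian ∧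
      (∀ c, Literature.Geometry.Lorentzian.pullbackBilin (I := 𝓡 4) (I' := 𝓡∂ 4) kC' γ'.val c =
      Literature.Geometry.Lorentzian.pullbackBilin (I := 𝓡 4) (I' := 𝓡∂ 4) kC γ.val c) ∧
      (∀ w, Literature.Geometry.Lorentzian.pullbackBilin (I := 𝓡 4) (I' := 𝓡∂ 4) kW' γ'.val w =
      Literature.Geometry.Lorentzian.pullbackBilin (I := 𝓡 4) (I' := 𝓡∂ 4) kW γ.val w))
    (S : Literature.Topology.FourManifolds.HomotopySphere 4) :
    ∃ (C : Type) (_ : TopologicalSpace C) (_ : ChartedSpace (EuclideanHalfSpace 4) C) (_ :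
      IsManifold (𝓡∂ 4) ∞ C) (V : Type) (_ : TopologicalSpace V) (_ : ChartedSpace (EuclideanHalfSpace
      4) V) (_ : IsManifold (𝓡∂ 4) ∞ V) (jC : C → (Metric.sphere (0 : EuclideanSpace ℝ (Fin 5)) 1))
      (jV : V → (Metric.sphere (0 : EuclideanSpace ℝ (Fin 5)) 1)) (kC : C → S.carrier) (kV : V →
      S.carrier) (g : Literature.Geometry.Lorentzian.PseudoRiemannianMetric (𝓡 4) ∞ (EuclideanSpace ℝ
      (Fin 4)) (TangentSpace (𝓡 4) : (Metric.sphere (0 : EuclideanSpace ℝ (Fin 5)) 1) → Type _)) (γ :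
      Literature.Geometry.Lorentzian.PseudoRiemannianMetric (𝓡 4) ∞ (EuclideanSpace ℝ (Fin 4))
      (TangentSpace (𝓡 4) : S.carrier → Type _)), CompactSpace C ∧ ContractibleSpace C ∧
      Manifold.IsSmoothEmbedding (𝓡∂ 4) (𝓡 4) ∞ jC ∧ Manifold.IsSmoothEmbedding (𝓡∂ 4) (𝓡 4) ∞ jV ∧
      Set.range jC ∪ Set.range jV = Set.univ ∧ (∀ c v, jC c = jV v → c ∈ (𝓡∂ 4).boundary C) ∧
      Manifold.IsSmoothEmbedding (𝓡∂ 4) (𝓡 4) ∞ kC ∧ Manifold.IsSmoothEmbedding (𝓡∂ 4) (𝓡 4) ∞ kV ∧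
      Set.range kC ∪ Set.range kV = Set.univ ∧ (∀ c v, kC c = kV v → c ∈ (𝓡∂ 4).boundary C) ∧ (∀ c,
      Literature.Geometry.Lorentzian.pullbackBilin (I := 𝓡 4) (I' := 𝓡∂ 4) jC g.val c =
      Literature.Geometry.Lorentzian.pullbackBilin (I := 𝓡 4) (I' := 𝓡∂ 4) kC γ.val c) ∧ (∀ v,
      Literature.Geometry.Lorentzian.pullbackBilin (I := 𝓡 4) (I' := 𝓡∂ 4) jV g.val v =
      Literature.Geometry.Lorentzian.pullbackBilin (I := 𝓡 4) (I' := 𝓡∂ 4) kV γ.val v) ∧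
      g.IsRiemannian ∧ γ.IsRiemannian ∧ ∃ _ : g.HasLeviCivita, (∀ x, 0 < g.scalarCurvature x) := by
  -- stub 1: the cork presentation `S⁴ = C ∪_φ W`, `Σ = C ∪_(φ∘τ) W`, `τ` involutive
  obtain ⟨C, instTC, instT2C, instSCC, instChC, instMC, instCompC, instContrC, bC, W, instTW, instT2W,
    instSCW, instChW, instMW, instCompW, bW, φ, τ, hτ, hS4, hSig⟩ := h1 S
  -- stub 2: piece embeddings of `S⁴` and a PSC metric on `S⁴` with a τ-symmetric germ along the seam
  obtain ⟨jC, jW, ⟨hjC, hjW, hcov, hseam⟩, g, U, T, hg, hLCscal, hU, hYU, hT, hTU, hTT, hTside, hTτ,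
    hTiso⟩ := h2 C bC W bW φ τ hτ hS4 S hSig
  -- stub 3: the isometric regluing `X = C ∪_(φ∘τ) W` of `(S⁴, g)`
  obtain ⟨X, instTX, instT2X, instSCX, instChX, instMX, kC₀, kW₀, γ₀, hkC₀, hkW₀, hcov₀, hseam₀, hγ₀,
    hpC₀, hpW₀⟩ :=
    h3 C bC W bW φ τ jC jW g U T hτ hjC hjW hcov hseam hg hU hYU hT hTU hTT hTside hTτ hTiso
  -- stub 4: transport to the given carrier `S.carrier` (another gluing along `φ ∘ τ`)
  obtain ⟨kC, kW, γ, hkC, hkW, hkcov, hkseam, hγ, hpC, hpW⟩ :=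
    h4 C bC W bW (τ.trans φ) X S.carrier kC₀ kW₀ γ₀ hkC₀ hkW₀ hcov₀ hseam₀ hγ₀ hSig
  obtain ⟨hLC, hscal⟩ := hLCscal
  refine ⟨C, instTC, instChC, instMC, W, instTW, instChW, instMW, jC, jW, kC, kW, g, γ, instCompC,
    instContrC, hjC, hjW, hcov, ?_, hkC, hkW, hkcov, ?_, ?_, ?_, hg, hγ, hLC, hscal⟩
  · -- seam points of the `S⁴`-gluing are boundary points of `C`
    intro c v hcv
    obtain ⟨z, hz, -⟩ := (hseam c v).1 hcv
    have hb : bC.incl z ∈ (𝓡∂ 4).boundary C := by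
      rw [← bC.range_incl]; exact Set.mem_range_self z
    rw [hz]; exact hb
  · -- seam points of the `Σ`-gluing are boundary points of `C`
    intro c v hcv
    obtain ⟨z, hz, -⟩ := (hkseam c v).1 hcv
    have hb : bC.incl z ∈ (𝓡∂ 4).boundary C := by
      rw [← bC.range_incl]; exact Set.mem_range_self z
    rw [hz]; exact hb
  · -- `jC^* g = kC₀^* γ₀ = kC^* γ`
    intro c
    exact (hpC₀ c).trans (hpC c).symm
  · -- `jW^* g = kW₀^* γ₀ = kW^* γ`
    intro w
    exact (hpW₀ w).trans (hpW w).symm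

/-- **THE SKELETON THEOREM: `WeylBudget.CorkRegluablePsc` BY NAME from the four declared stubs**
(`ledger skeleton check` shape: no hypotheses; `sorry` enters only through `stub_*`). [folklore] -/
theorem CorkRegluablePsc_of :
    Summit.SmoothPoincare4.SmoothPoincare4.Theses.WeylBudget.CorkRegluablePsc := by
  intro S
  exact corkRegluablePsc_of_stubSigs stub_corkPresentation symmetricPscGerm_of_stubs
    stub_isometricRegluing stub_isometricTransport S

end Summit.SmoothPoincare4.SmoothPoincare4.Cruxes.CorkRegluablePsc.Birth

end
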